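import Literature.AnabelianGeometry.AbsoluteAnabelian.AbsTopIII.ReconstructionCor110NatResidue
import Literature.AnabelianGeometry.AbsoluteAnabelian.GaloisCyclotomeRestrictionIndex
import HarnessLib

/-!
# [AbsTopIII] Cor. 1.10 (i)(a) / Rmk. 1.10.1 (iii) — the index formula for the `Ẑ`-valued residue
# under restriction to a finite extension, for restriction-compatible cyclotome data

Mochizuki, *Topics in Absolute Anabelian Geometry III*, Rmk. 1.10.1 (iii) p. 44 (manuscript pagination,
lit key `paper:url-5493eb38cbb7`): «the isomorphism `H²(G_k, μ_Ẑ(G_k)) ⥲ Ẑ` of Corollary 1.10, (a), is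
functorial in the sense that it is compatible with the result of dividing the usual functorially induced
morphism by a factor given by the index of the open subgroups of `G_k` under consideration» — i.e. for a
finite extension `k′/k`, `Res : H²(G_k, μ_Ẑ(G_k)) → H²(G_{k′}, μ_Ẑ(G_{k′}))` (abc-iut-w5-d201's
`galCyclotomeRes k k′ 2`, over the GROUP-THEORETIC cyclotomes) multiplies the `Ẑ`-valued residue by the
index `[k′ : k]` (Serre, *Local Fields* XIII §3 Prop. 7: `inv_{k′} ∘ Res = [k′ : k] · inv_k`).

This proof-only file (abc-iut cell, layer L4, row «COR110ia-NAT-OPEN», abc-iut-L4-d3; clause (3) of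
abc-iut-L4-d1's `AbsTopIII.Cor_1_10_i_a_resNatural`, `ReconstructionCor110iaNatural.lean`) proves the index
formula for the `Ẑ`-valued residue of the (N)/(a)-family route (abc-iut-L4-t11's
`galCyclotomeIsoTateModule` ≫ `continuousCohomologyTwoTateModuleEquiv` ≫ `cohomologyLimitMuEquivZHat`)
for ANY pair of cyclotome identifications `φ : μ_{ℚ/ℤ}(G_k) ≅ μ(k̄)`, `φ′ : μ_{ℚ/ℤ}(G_{k′}) ≅ μ(k̄′)` that
are RESTRICTION-COMPATIBLE — `φ′ = ι ∘ φ ∘ μ_{ℚ/ℤ}(res)` pointwise (hypothesis `hres`; for the induced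
identification `inducedCyclotomeEquiv k k′ φ` it holds by `rfl`; for THE characterised LCFT data of `k` and
`k′` it is the restriction-compatibility of local class field theory, supplied separately):

* `projHom_galCyclotomeIsoTateModule_apply` / `cohomologyMap_projHom_galCyclotomeIsoTateModule` — junction of
  abc-iut-L4-t11's `Ẑ(1)`-route with abc-iut-L4-t17's tower projections: `proj_n ∘ i_φ = cycProj φ n`;
* `cycProj_congr` — `cycProj` only depends on the values of `φ`;
* `invMap_eq_invLevel` — the two names of THE invariant map in the tree agree (uniqueness);
* `level_residue_galCyclotomeRes_of_compatible` — **clause (3) for compatible data**: for all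
  `x ∈ H²(G_k, μ_Ẑ(G_k))` and `n ≥ 1`, `level_n (residue_{k′} (Res x)) = [k′ : k] · level_n (residue_k x)`
  (w5-d201's `cohomologyMap_cycProj_galCyclotomeRes` + `Prop121vii.invLevel_resMu`);
* `residue_galCyclotomeRes_of_compatible` — the same in `Ẑ`: `residue_{k′} (Res x) = [k′ : k] • residue_k x`.

Theorems only (no definitions, no named facts, no `sorry`); universe `0` (that of the (N)/(a) statements).  HONEST FRAMING: classical local class field
theory; [AbsTopIII] is a refereed paper; nothing here bears on [IUTchIII] Cor. 3.12 or takes a side.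
-/

noncomputable section

open CategoryTheory Function
open Field IsNonarchimedeanLocalField ValuativeRel
open ProfiniteGrp ProfiniteGrp.ProfiniteCompletion

namespace Literature.AnabelianGeometry.AbsoluteAnabelian

open _root_.TopRep _root_.ContRepresentation _root_.ContinuousCohomology
open Literature.NumberTheory.GaloisRepresentations
open Literature.NumberTheory.GaloisRepresentations.DiscreteGaloisModule
open Literature.AnabelianGeometry.EtaleTheta Literature.AnabelianGeometry.EtaleTheta.ZHatLevel

namespace Cor110Nat

/-! ### Junction: `proj_n ∘ (μ_Ẑ(G_k) ≅ Ẑ(1)(k̄)) = cycProj φ n` -/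

section Junction

variable {k : Type} [Field k] [CharZero k]
  (φ : muQZ (absoluteGaloisGroup k) ≃+ Additive (CommGroup.torsion (AlgebraicClosure k)ˣ))
  (hφ : ∀ (σ : absoluteGaloisGroup k) (x : muQZ (absoluteGaloisGroup k)),
    (((Additive.toMul (φ (σ • x)) : CommGroup.torsion (AlgebraicClosure k)ˣ) :
        (AlgebraicClosure k)ˣ) : AlgebraicClosure k) =
      σ • (((Additive.toMul (φ x) : CommGroup.torsion (AlgebraicClosure k)ˣ) :
        (AlgebraicClosure k)ˣ) : AlgebraicClosure k))

/-- **Junction on elements**: the `n`-th coordinate of abc-iut-L4-t11's `μ_Ẑ(G_k) ≅ Ẑ(1)(k̄)`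
(`galCyclotomeIsoTateModule k φ hφ`) is abc-iut-L4-t17's tower projection `cycProj φ hφ n` — both are
`z ↦ φ(z_n) ∈ μ_n(k̄)`. [cite: MochizukiAbsTopIII2015, Cor 1.10 (i) p.42] -/
theorem projHom_galCyclotomeIsoTateModule_apply (n : ℕ+) (m : MuZhatMod (absoluteGaloisGroup k)) :
    ((muSystem k).projHom n).hom ((galCyclotomeIsoTateModule k φ hφ).hom.hom m) = (cycProj φ hφ n).hom m := by
  apply muVal_injective k n
  rw [muVal_cycProj_hom, DiscreteInvSystem.projHom_hom_apply]
  change muVal k n ((toTateModule k φ m : ∀ n : ℕ+, MuCarrier k n) n) = _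
  rw [muVal_toTateModule]
  rfl

/-- **Junction on `H²`**: `H²(proj_n) (H²(i_φ) x) = H²(cycProj φ n) x` for every class
`x ∈ H²(G_k, μ_Ẑ(G_k))`. [cite: MochizukiAbsTopIII2015, Cor 1.10 (i) p.42] -/
theorem cohomologyMap_projHom_galCyclotomeIsoTateModule (n : ℕ+)
    (x : continuousCohomology 2 (galCyclotomeTopRep (absoluteGaloisGroup k))) :
    (cohomologyMap ((muSystem k).projHom n) 2).hom
        ((cohomologyMap (galCyclotomeIsoTateModule k φ hφ).hom 2).hom x) =
      (cohomologyMap (cycProj φ hφ n) 2).hom x := by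
  obtain ⟨c, rfl⟩ := twoCocycleClass_surjective _ x
  rw [cohomologyMap_hom_twoCocycleClass, cohomologyMap_hom_twoCocycleClass, cohomologyMap_hom_twoCocycleClass]
  refine congrArg (twoCocycleClass _) (Subtype.ext (ContinuousMap.ext fun p => ?_))
  obtain ⟨σ, τ⟩ := p
  rw [contTwoCocycles.push_apply, contTwoCocycles.push_apply, contTwoCocycles.push_apply]
  exact projHom_galCyclotomeIsoTateModule_apply φ hφ n _

/-- `cycProj` only depends on the VALUES of the identification `φ` (not on the equivariance witness or
the syntactic form of `φ`). [cite: MochizukiAbsTopIII2015, Cor 1.10 (i) p.42] -/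
theorem cycProj_congr
    {φ' : muQZ (absoluteGaloisGroup k) ≃+ Additive (CommGroup.torsion (AlgebraicClosure k)ˣ)}
    (hφ' : ∀ (σ : absoluteGaloisGroup k) (x : muQZ (absoluteGaloisGroup k)),
      (((Additive.toMul (φ' (σ • x)) : CommGroup.torsion (AlgebraicClosure k)ˣ) :
          (AlgebraicClosure k)ˣ) : AlgebraicClosure k) =
        σ • (((Additive.toMul (φ' x) : CommGroup.torsion (AlgebraicClosure k)ˣ) :
          (AlgebraicClosure k)ˣ) : AlgebraicClosure k))
    (h : ∀ x, φ x = φ' x) (n : ℕ+) : cycProj φ hφ n = cycProj φ' hφ' n := by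
  have : φ = φ' := AddEquiv.ext h
  subst this
  rfl

end Junction

/-! ### The two names of THE invariant map agree -/

section Inv

variable (K : Type) [Field K] [ValuativeRel K] [TopologicalSpace K] [IsNonarchimedeanLocalField K]
  [CharZero K]

/-- abc-iut-L4-t11's `invMap K n` (`LocalTateModuleH2.lean`) and abc-iut-w5-d201's `Prop121vii.invLevel K n`
(`LocalResidueMapQmodZ.lean`) are both THE invariant map of level `n` (`IsInvariantMap`, unique by
`Prop121vii.existsUniqueInvariantMap_holds`), hence equal. [cite: MochizukiAbsAnab2004, Prop 1.2.1 (vii) p.11] -/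
theorem invMap_eq_invLevel (n : ℕ+) :
    haveI : NeZero ((n : ℕ+) : ℕ) := NeZero.of_pos n.pos
    invMap K n = Prop121vii.invLevel K n := by
  haveI : NeZero ((n : ℕ+) : ℕ) := NeZero.of_pos n.pos
  haveI : Finite (MuCarrier K n) := finite_muCarrier K n
  exact Prop121vii.eq_invLevel K (isInvariantMap_invMap K n)

end Inv

/-! ### Clause (3): the index formula for restriction-compatible data -/

section Index

variable {k k' : Type} [Field k] [ValuativeRel k] [TopologicalSpace k] [IsNonarchimedeanLocalField k]
  [CharZero k] [Field k'] [ValuativeRel k'] [TopologicalSpace k'] [IsNonarchimedeanLocalField k']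
  [CharZero k'] [Algebra k k'] [FiniteDimensional k k']
  (φ : muQZ (absoluteGaloisGroup k) ≃+ Additive (CommGroup.torsion (AlgebraicClosure k)ˣ))
  (hφ : ∀ (σ : absoluteGaloisGroup k) (x : muQZ (absoluteGaloisGroup k)),
    (((Additive.toMul (φ (σ • x)) : CommGroup.torsion (AlgebraicClosure k)ˣ) :
        (AlgebraicClosure k)ˣ) : AlgebraicClosure k) =
      σ • (((Additive.toMul (φ x) : CommGroup.torsion (AlgebraicClosure k)ˣ) :
        (AlgebraicClosure k)ˣ) : AlgebraicClosure k))
  (φ' : muQZ (absoluteGaloisGroup k') ≃+ Additive (CommGroup.torsion (AlgebraicClosure k')ˣ))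
  (hφ' : ∀ (σ : absoluteGaloisGroup k') (x : muQZ (absoluteGaloisGroup k')),
    (((Additive.toMul (φ' (σ • x)) : CommGroup.torsion (AlgebraicClosure k')ˣ) :
        (AlgebraicClosure k')ˣ) : AlgebraicClosure k') =
      σ • (((Additive.toMul (φ' x) : CommGroup.torsion (AlgebraicClosure k')ˣ) :
        (AlgebraicClosure k')ˣ) : AlgebraicClosure k'))
  (hres : ∀ x : muQZ (absoluteGaloisGroup k'), φ' x = inducedCyclotomeEquiv k k' φ x)

include hres in
/-- **Clause (3), levelwise, for RESTRICTION-COMPATIBLE data** ([AbsTopIII] Rmk. 1.10.1 (iii); Serre XIII §3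
Prop. 7): if `φ′ = ι ∘ φ ∘ μ_{ℚ/ℤ}(res)` (i.e. `φ′` takes the values of `inducedCyclotomeEquiv k k′ φ`), then
for every `x ∈ H²(G_k, μ_Ẑ(G_k))` and `n ≥ 1` the level-`n` residue of `Res x` read in `k′` through `φ′` is
`[k′ : k]` times the level-`n` residue of `x` read in `k` through `φ`:
`inv_{k′,n}(proj_n (H²(i_{φ′}) (Res x))) = [k′ : k] · inv_{k,n}(proj_n (H²(i_φ) x))`.
[cite: MochizukiAbsTopIII2015, Remark 1.10.1 p.44] -/
theorem level_residue_galCyclotomeRes_of_compatible (n : ℕ+)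
    (x : continuousCohomology 2 (galCyclotomeTopRep (absoluteGaloisGroup k))) :
    Multiplicative.toAdd (level n (Additive.toMul (cohomologyLimitMuEquivZHat k'
        (continuousCohomologyTwoTateModuleEquiv k'
          ((cohomologyMap (galCyclotomeIsoTateModule k' φ' hφ').hom 2).hom ((galCyclotomeRes k k' 2).hom x)))))) =
      (Module.finrank k k' : ZMod n) *
        Multiplicative.toAdd (level n (Additive.toMul (cohomologyLimitMuEquivZHat k
          (continuousCohomologyTwoTateModuleEquiv k
            ((cohomologyMap (galCyclotomeIsoTateModule k φ hφ).hom 2).hom x))))) := by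
  haveI : NeZero ((n : ℕ+) : ℕ) := NeZero.of_pos n.pos
  rw [level_residueZHat, level_residueZHat, cohomologyMap_projHom_galCyclotomeIsoTateModule,
    cohomologyMap_projHom_galCyclotomeIsoTateModule,
    cycProj_congr φ' hφ' (inducedCyclotomeEquiv_smul k k' φ hφ) hres n,
    cohomologyMap_cycProj_galCyclotomeRes k k' φ hφ n x, invMap_eq_invLevel, invMap_eq_invLevel]
  exact Prop121vii.invLevel_resMu k k' n _

include hres in
/-- **Clause (3) in `Ẑ`, for restriction-compatible data**: `residue_{k′} (Res x) = [k′ : k] • residue_k x`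
in `Ẑ` (an element of `Ẑ` is determined by its levels, `ext_of_level`).
[cite: MochizukiAbsTopIII2015, Remark 1.10.1 p.44] -/
theorem residue_galCyclotomeRes_of_compatible
    (x : continuousCohomology 2 (galCyclotomeTopRep (absoluteGaloisGroup k))) :
    cohomologyLimitMuEquivZHat k' (continuousCohomologyTwoTateModuleEquiv k'
        ((cohomologyMap (galCyclotomeIsoTateModule k' φ' hφ').hom 2).hom ((galCyclotomeRes k k' 2).hom x))) =
      (Module.finrank k k') • cohomologyLimitMuEquivZHat k (continuousCohomologyTwoTateModuleEquiv k
        ((cohomologyMap (galCyclotomeIsoTateModule k φ hφ).hom 2).hom x)) := by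
  apply Additive.toMul.injective
  refine ext_of_level fun n => Multiplicative.toAdd.injective ?_
  rw [level_residue_galCyclotomeRes_of_compatible φ hφ φ' hφ' hres n x, toMul_nsmul, map_pow, toAdd_pow,
    nsmul_eq_mul]

end Index

end Cor110Nat

end Literature.AnabelianGeometry.AbsoluteAnabelian
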